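import Summits.ABC.ABC.Theses.DefiniteXi
import Summits.ABC.ABC.Theses.IsogenyGlueCongruence
import Summits.ABC.ABC.Theses.RibetTakahashiSplit
import Summits.ABC.ABC.Theorems.DefiniteXiDefiniteRTControlPrimeOfTakahashi
import Summits.ABC.ABC.Theorems.IsogenyGlueCongruenceMazurKenkuBoundSplitGlue
import Summits.ABC.ABC.Theorems.IsogenyGlueCongruenceKenkuCompositeTables
import Summits.ABC.ABC.Theorems.IsogenyGlueCongruenceKenkuLevelFortyNine
import Literature.NumberTheory.EllipticCurves.KleinFrickeLevelSevenJZero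
import Literature.NumberTheory.EllipticCurves.KenkuMinimalLevels
import Literature.NumberTheory.EllipticCurves.PastenHeightBoundsLemma68LocalProofs
import Literature.NumberTheory.EllipticCurves.RationalIsogenyDegreesProofs
import HarnessLib

/-!
# STUB-PLAN certificate, gen 4 — `stub_pastenLemma68 : PastenShimura2024_lemma_6_8` (crux stmt-ABC-11338)

Stub-critic scratch check (planner, mode stub-critic, unit `scrit-stmt-ABC-11338-stub_pastenLem-g4`).
Every claim of STUB-PLAN rev 4 is a named, sorry-free theorem below; `lean check` rc 0 / 0 sorries
certifies them together.  NEW over the gen-1–3 certificate (`StubPlanCertPastenLemma68.lean`, C1–C6):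

* G1  the route's radius decl `DefiniteXi.MazurKenkuRadius` (item stmt-ABC-15193, `aside`, never
      served) IS `RibetTakahashiSplit.MazurKenkuRadius` and `IsogenyGlueCongruence.MazurKenkuRadius`
      (`Iff.rfl`) — the conclusion of the registered line `Cruxes/MazurKenkuBound/Lines/radius_lite.lean`
      (`mazurKenkuRadius_of_liteStubs`) of the SERVED crux stmt-ABC-15125;
* G3/G4  the verbatim stub from EXACTLY the two OPEN, SERVED split children of stmt-ABC-15125 on
      route IsogenyGlueCongruence — `MazurCor44` (stmt-ABC-18223, r901) and `KenkuPrintedLevels`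
      (stmt-ABC-18224, r902) — the closed children `KenkuCompositeTables` (18225) and
      `KenkuLevelFortyNine` (18226) and Klein–Fricke at `7` being supplied BY NAME from the tree;
* G5  the stub from the two BSD-shared named facts `mazur_isogeny_irreducible` +
      `kenku_minimalLevels_mem_kenkuDegrees` (one-liner; the dedup door).
-/

set_option linter.dupNamespace false

noncomputable section

open scoped Classical

namespace Summit.ABC.ABC.Cruxes.DefiniteRTControlPrime.StubPlanG4PastenLemma68

open Summit.ABC.ABC.Theses
open Literature.NumberTheory.EllipticCurves Literature.NumberTheory.EllipticCurves.ModularForms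
open WeierstrassCurve

/-- G0. The stub IS route item stmt-ABC-18928 (`DefiniteXi.IsogenyValuationTransport`), definitionally. -/
theorem stub_iff_item : PastenShimura2024_lemma_6_8 ↔ DefiniteXi.IsogenyValuationTransport := Iff.rfl

/-- G1a. Item stmt-ABC-15193 has one body under three route decls: DefiniteXi's copy is RibetTakahashiSplit's. -/
theorem radius_iff_rts : DefiniteXi.MazurKenkuRadius ↔ RibetTakahashiSplit.MazurKenkuRadius := Iff.rfl

/-- G1b. … and IsogenyGlueCongruence's. -/
theorem radius_iff_igc : DefiniteXi.MazurKenkuRadius ↔ IsogenyGlueCongruence.MazurKenkuRadius := Iff.rfl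

/-- G1c. Item stmt-ABC-18223 `MazurCor44` IS the named fact `Mazur1978.cor44_valuation_j_le_one`. -/
theorem cor44_iff_item : Mazur1978.cor44_valuation_j_le_one ↔ IsogenyGlueCongruence.MazurCor44 := Iff.rfl

/-- G2. Closer from the radius (= gen-1 C3 `stub_of_radius`, = k1 `R1_stub_of_radius`, = k2
`stub_of_radiusItem`): cyclic factor of a degree-`≤ 163` isogeny + the Mazur-free cyclic transport. -/
theorem stub_of_radius (hR : DefiniteXi.MazurKenkuRadius) : PastenShimura2024_lemma_6_8 := by
  intro W W' _ _ hiso v hv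
  have hv' : W'.HasMultiplicativeReductionAt v := hasMultiplicativeReductionAt_of_isIsogenous hiso v hv
  obtain ⟨φ, hφ⟩ := hR W W' hiso
  obtain ⟨ψ, hψ, hdvd⟩ := φ.exists_isCyclic_degree_dvd
  have hψB : ψ.degree ≤ 163 := (Nat.le_of_dvd φ.degree_pos hdvd).trans hφ
  obtain ⟨a, b, ha, hb, hab, h⟩ :=
    exists_ordMinimalDiscriminant_mul_eq_mul_of_isCyclic ψ.degree ψ hψ rfl v hv hv'
  have habn : a * b ≤ ψ.degree := Nat.le_of_dvd ψ.degree_pos hab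
  refine ⟨a, b, ha, ?_, hb, ?_, h⟩
  · have : a ≤ a * b := Nat.le_mul_of_pos_right a hb
    omega
  · have : b ≤ a * b := Nat.le_mul_of_pos_left b ha
    omega

/-- G3. The Mazur–Kenku radius (stmt-ABC-15193) from EXACTLY the two OPEN split children of crux
stmt-ABC-15125 on route IsogenyGlueCongruence — `MazurCor44` (18223) and `KenkuPrintedLevels` (18224);
the closed children (18225 `kenkuCompositeTables_proof`, 18226 `kenkuLevelFortyNine_proof`) and
Klein–Fricke at `7` over `ℚ` are tree theorems.  Body = the landed glue `mazurKenkuBoundGlue_proof`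
with `mazurKenkuBound_of_eight` replaced by its radius twin `mazurKenkuRadius_of_eight`. -/
theorem radius_of_igcChildren (hA : IsogenyGlueCongruence.MazurCor44)
    (hB : IsogenyGlueCongruence.KenkuPrintedLevels) :
    RibetTakahashiSplit.MazurKenkuRadius := by
  refine Summit.ABC.ABC.Theorems.mazurKenkuRadius_of_eight hA ?_ ?_
    (fun W W' _ φ h7 ↦ φ.exists_j_eq_klein_seven_of_degree_eq_seven h7
      (φ.j_ne_zero_of_degree_eq_seven_rat h7))
  · -- `hT8`: the eight non-`15, 21` table levels (seven prime levels from child B(i), `27` from closed C₁)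
    intro V V' _ _ ψ hψ hmem
    have hsplit : ∀ n ∈ ({11, 17, 19, 27, 37, 43, 67, 163} : Finset ℕ),
        n = 27 ∨ n ∈ ({11, 17, 19, 37, 43, 67, 163} : Finset ℕ) := by decide
    rcases hsplit _ hmem with h27 | h7
    · have h := Summit.ABC.ABC.Theorems.kenkuCompositeTables_proof V V' ψ hψ (by rw [h27]; decide)
      exact Summit.ABC.ABC.Theorems.splitRows_sub_kenkuIsogenyJTable _
        (Finset.mem_of_subset (by decide +kernel) h)
    · have h := hB.1 V V' ψ hψ h7
      exact Summit.ABC.ABC.Theorems.splitRows_sub_kenkuIsogenyJTable _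
        (Finset.mem_of_subset (by decide +kernel) h)
  · -- `hL6`: the six smooth levels (five from child B(ii), `49` from closed C₂)
    intro V V' _ _ ψ hψ hmem
    have hsplit : ∀ n ∈ ({26, 35, 49, 65, 125, 169} : Finset ℕ),
        n = 49 ∨ n ∈ ({26, 35, 65, 125, 169} : Finset ℕ) := by decide
    rcases hsplit _ hmem with h49 | h5
    · exact Summit.ABC.ABC.Theorems.kenkuLevelFortyNine_proof V V' ψ hψ h49
    · exact hB.2 V V' ψ hψ h5

/-- G4. **The verbatim stub's exact residual debt**: items stmt-ABC-18223 ∧ stmt-ABC-18224 (both open,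
both SERVED as IGC cruxes r901/r902) ⟹ `PastenShimura2024_lemma_6_8`, sorry-free glue. -/
theorem stub_of_igcChildren (hA : IsogenyGlueCongruence.MazurCor44)
    (hB : IsogenyGlueCongruence.KenkuPrintedLevels) : PastenShimura2024_lemma_6_8 :=
  stub_of_radius (radius_of_igcChildren hA hB)

/-- G4'. … and route item stmt-ABC-18928 with it. -/
theorem item18928_of_igcChildren (hA : IsogenyGlueCongruence.MazurCor44)
    (hB : IsogenyGlueCongruence.KenkuPrintedLevels) : DefiniteXi.IsogenyValuationTransport :=
  stub_of_igcChildren hA hB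

/-- G5. The dedup door: the stub from the two BSD-shared named facts (Mazur 1978 Thm 1 in Galois-image
form, Kenku's minimal levels), via the tree's `mazurKenku_exists_cyclic_isogeny_of_mazur_of_kenku`. -/
theorem stub_of_mazurThm1_of_kenku (hM : mazur_isogeny_irreducible)
    (hK : kenku_minimalLevels_mem_kenkuDegrees) : PastenShimura2024_lemma_6_8 :=
  PastenShimura2024_lemma_6_8_of_mazurKenku' (mazurKenku_exists_cyclic_isogeny_of_mazur_of_kenku hM hK)

/-- G6. Closer from the Literature named fact itself (tree one-liner). -/
theorem stub_of_mazurKenku (hMK : mazurKenku_exists_cyclic_isogeny) : PastenShimura2024_lemma_6_8 :=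
  PastenShimura2024_lemma_6_8_of_mazurKenku' hMK

/-- G7. DEPTH certificate: the stub implies Mazur's bound `ℓ ≤ 163` for prime-degree `ℚ`-isogenies out
of any curve with a multiplicative place, `v ∋ 2` included (tree). -/
theorem mazurBound_of_stub (h68 : PastenShimura2024_lemma_6_8)
    {W W' : WeierstrassCurve ℚ} [W.IsElliptic] [W'.IsElliptic] (φ : Isogeny W W') {ℓ : ℕ}
    (hℓ : ℓ.Prime) (hdeg : φ.degree = ℓ) (v : IsDedekindDomain.HeightOneSpectrum ℤ)
    (hv : W.HasMultiplicativeReductionAt v) : ℓ ≤ 163 :=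
  prime_degree_le_163_of_PastenShimura2024_lemma_6_8 h68 φ hℓ hdeg v hv

/-- G8. The stub is MOOT for the crux: the crux from `stub_takahashi` ALONE (landed p839521). -/
theorem crux_of_takahashi_alone (hT : takahashi2001_thm_2_3_of_coprime) :
    DefiniteXi.DefiniteRTControlPrime :=
  Summit.ABC.ABC.Theorems.DefiniteRTControlPrime.definiteRTControlPrime_of_takahashi hT

end Summit.ABC.ABC.Cruxes.DefiniteRTControlPrime.StubPlanG4PastenLemma68

end
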